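import Summits.BirchSwinnertonDyer.Rank1Residual.GaloisImage.HauptmodulNineTowerSeven
import Summits.BirchSwinnertonDyer.Rank1Residual.GaloisImage.HauptmodulNineValuationVZeroFour
import HarnessLib

/-!
# The `3`-adic tower on `v₃(j) ≡ 0 (mod 3)`, `v₃(j) ≥ 6`, `j/3^{v₃(j)} ≡ ±4 (mod 9)`:
# `ρ̄_{E,3}` onto implies `ρ̄_{E,3ⁿ}` onto for every `n` — the `K ≡ ±4` twin of
# `HauptmodulNineTowerVZero` (cell `b2b-bsdres`, team n1011, seat p02 gen 6 — row T-b11-F4-END,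
# file F4c-H22)

HONEST FRAMING (cell `b2b-bsdres`, run/shared/lean/b2b/bsd-rank1-residual/, verbatim in every
file): the goal of the cell is to DELETE the COMBINATION-SHAPED residual classes of the
Birch–Swinnerton-Dyer formula for ALL analytic-rank `≤ 1` elliptic curves over `ℚ` — "full BSD
formula for every rank `≤ 1` curve in class `C`" assembled STRICTLY from published theorems — so
that the rank-`≤ 1` remainder becomes exactly the CONSTRUCTION-SHAPED classes, which are TYPED
(missing-input `Prop`s), NOT attempted. This is not "finishing BSD". Team n1011 (N10 / N11):
research route; no claim beyond the stated classes; labels UNCHANGED; nothing is booked. Theorems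
only (no definition, no named fact).

## What this file proves

* **`towerSurj_three_of_surj_of_nine_dvd_num_vzero_four`** — for `E/ℚ` with `ρ̄_{E,3}` onto,
  `k ≥ 1`, `w₀ = ±1` and `9 ∣ num(j(E)/3^{3k+3} − 4w₀)` (i.e. `v₃(j) = 3k + 3` and
  `j/3^{v₃(j)} ≡ 4w₀ ≡ ±4 (mod 9)`): `ρ̄_{E,3ⁿ}` is onto for every `n`.  Same invariant
  `z = (2((θ³ − 24)/3^{k+1} − w₀)/θ)² − 1` of valuation `1/9` as the `K ≡ −2w₀` family
  (`HauptmodulNineValuationVZeroFour`); scalar-stabiliser criterion with `(d, a, b) = (9, 0, 1)`.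
* `imageContainsSL2_three_of_surj_of_nine_dvd_num_vzero_four` — Kato's (12.5.2) at `p = 3`.

With `HauptmodulNineTowerVZero` the Hauptmodul route now covers `v₃(j) ≡ 0 (mod 3)`, `v₃(j) ≥ 6`
for EVERY `K = j/3^{v₃(j)} ≢ ±1 (mod 9)`; the class `K ≡ ±4` has no cell in the cell's `m = 3`
census (it is filed for the sharpness of the EXOTIC signature; EVIDENCE on synthetic `j`:
kit j137075, 11/11).  NOT claimed: `K ≡ ±1 (mod 9)` (no prime of `ℚ(θ)` over `3` with `9 ∣ ef`).
Nothing booked; no label change.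

References: [Maier2006] Table 4 (N = 3, 9), §5; [SerreAbelianLadic1968] IV-23;
[SerreLocalFields1979] Ch. I §7; [Kato2004Asterisque] (12.5.2).
-/

noncomputable section

set_option maxRecDepth 10000

open scoped Classical

open WeierstrassCurve Field

namespace Summit.BirchSwinnertonDyer.Rank1Residual.GaloisImage

open Literature.NumberTheory.EllipticCurves Literature.NumberTheory.GaloisRepresentations
  Rat.HeightOneSpectrum

variable (W : WeierstrassCurve ℚ) [W.IsElliptic]

/-- **THE TOWER AT `v₃(j) = 3k + 3 ≥ 6`, `j/3^{v₃(j)} ≡ ±4 (mod 9)`.**  For `E/ℚ` with `ρ̄_{E,3}`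
onto, `k ≥ 1`, `w₀ = ±1` and `9 ∣ num(j/3^{3k+3} − 4w₀)`, `ρ̄_{E,3ⁿ}` is onto for every `n`
(level-`9` Hauptmodul: the `Stab(ℤQ)`-invariant `z = (2((θ³ − 24)/3^{k+1} − w₀)/θ)² − 1 ∈ ℚ(E[9])`,
`θ = η(E, ℤQ) + 3`, has `3`-adic valuation exactly `1/9`; scalar-stabiliser tower criterion).
[cite: SerreAbelianLadic1968, Ch. IV §3.4, Lemma 3 (IV-23)] [cite: Maier2006, Table 4 (N = 9) and §5] -/
theorem towerSurj_three_of_surj_of_nine_dvd_num_vzero_four (hsurj : W.HasSurjectiveModNGaloisRep 3)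
    {k : ℕ} (hk : 1 ≤ k) {w₀ : ℤ} (hw₀ : w₀ = 1 ∨ w₀ = -1)
    (hj0 : (9 : ℤ) ∣ (W.j / 3 ^ (3 * k + 3) - ((4 * w₀ : ℤ) : ℚ)).num) (n : ℕ) :
    W.HasSurjectiveModNGaloisRep (3 ^ n : ℕ) := by
  haveI : Fact (Nat.Prime 3) := ⟨Nat.prime_three⟩
  set v := (placeOver 3).valuation with hv
  set t := v (3 : AlgebraicClosure ℚ) with ht
  have ht0 : t ≠ 0 := valuation_three_ne_zero
  have hc3 : ¬ (3 : ℤ) ∣ 4 * w₀ := by rcases hw₀ with h | h <;> rw [h] <;> decide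
  have hjV := (padicValRat_eq_of_nine_dvd_num_sub (V := 3 * k + 3) hc3 hj0).1
  obtain ⟨Q, θ, hQ₉, hθL, hθfix, hjθ, hvS⟩ :=
    exists_nineTorsion_hauptmodulNine_of_four_le W (by rw [hjV]; push_cast; omega)
  -- the curve-free core: `v(z)⁹ = t`
  have hz := valuation_hauptmodul_nine_invariant_vzero_four_pow_nine hk hw₀ hj0 hjθ hvS rfl
  set z := (2 * ((θ ^ 3 - 24) / 3 ^ (k + 1) - (w₀ : AlgebraicClosure ℚ)) / θ) ^ 2 - 1 with hzdef
  have hz0 : z ≠ 0 := by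
    intro h0
    rw [h0, map_zero, zero_pow (by norm_num)] at hz
    exact ht0 hz.symm
  have hzL : z ∈ W.divisionField 9 :=
    sub_mem (pow_mem (div_mem (mul_mem (ofNat_mem _ 2) (sub_mem (div_mem (sub_mem (pow_mem hθL 3)
      (ofNat_mem _ 24)) (pow_mem (ofNat_mem _ 3) (k + 1))) (intCast_mem _ w₀))) hθL) 2) (one_mem _)
  have hfix : ∀ σ : absoluteGaloisGroup ℚ, (∃ c : ℤ, σ • Q = c • Q) → σ • z = z := by
    intro σ hσ
    have hθ' : absoluteGaloisGroup.toAlgEquiv ℚ σ θ = θ := by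
      rw [← absoluteGaloisGroup.smul_def]; exact hθfix σ hσ
    rw [absoluteGaloisGroup.smul_def, hzdef]
    simp only [map_sub, map_div₀, map_mul, map_pow, map_ofNat, map_one, map_intCast, hθ']
  -- the scalar-stabiliser tower criterion with `d = 9`, `a = 0`, `b = 1`
  have hval : v z ^ 9 * t ^ 0 = t ^ 1 := by rw [pow_zero, mul_one, pow_one]; exact hz
  have hcop : IsCoprime ((9 : ℕ) : ℤ) (((0 : ℕ) : ℤ) - ((1 : ℕ) : ℤ)) := ⟨0, -1, by norm_num⟩
  exact towerSurj_three_of_surj_of_valuation_of_smul_zmultiples W hsurj hQ₉ hzL hz0 hfix hval hcop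
    (dvd_refl 9) n

/-- **Kato's (12.5.2) at `p = 3` on the family `v₃(j) = 3k + 3 ≥ 6`, `j/3^{v₃(j)} ≡ ±4 (mod 9)`**
from surj(3). [cite: Kato2004Asterisque, (12.5.2) (p. 222)] [cite: SerreAbelianLadic1968, Ch. IV §3.4, Lemma 3 (IV-23)] -/
theorem imageContainsSL2_three_of_surj_of_nine_dvd_num_vzero_four
    (hsurj : W.HasSurjectiveModNGaloisRep 3) {k : ℕ} (hk : 1 ≤ k) {w₀ : ℤ}
    (hw₀ : w₀ = 1 ∨ w₀ = -1) (hj0 : (9 : ℤ) ∣ (W.j / 3 ^ (3 * k + 3) - ((4 * w₀ : ℤ) : ℚ)).num) :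
    Kato2004.ImageContainsSL2 W 3 := by
  haveI : Fact (Nat.Prime 3) := ⟨Nat.prime_three⟩
  exact (Kato2004.imageContainsSL2_iff_forall_hasSurjectiveModNGaloisRep W 3).mpr
    (towerSurj_three_of_surj_of_nine_dvd_num_vzero_four W hsurj hk hw₀ hj0)

end Summit.BirchSwinnertonDyer.Rank1Residual.GaloisImage
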